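import Literature.NumberTheory.Transcendental.KZFibredRelations
import Literature.NumberTheory.Transcendental.SemialgebraicMapsProofs

/-!
# Route ValuedFieldSpecialisation — crux `CTConstruction`: polynomial weights in the parameter preserve fibred relations

Helper toward crux stmt-KontsevichZagierPeriods-3495 (`CTConstruction`), line `registered`, stubs
`stub_weightMap_mem_fibredRelations` and `stub_exists_weightRestrict`. An `(k+1)`-dimensional integral
representation is read as the family of its slices over the parameter `s = z 0`; the fibred relations
`KZ.fibredRelations = AddSubgroup.closure KZ.fibredGenerators`
(`Literature/NumberTheory/Transcendental/KZFibredRelations.lean`) are generated by the moves of the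
Kontsevich–Zagier calculus applied uniformly in the parameter. This file proves the structural fact that
**fibred relations are a module over the polynomial weights `s ^ m` of the parameter**: restricting every
family to the slab `{0 < z 0 < 1}` and multiplying its integrand by `(z 0) ^ m` commutes with all four
kinds of fibred generators —

* domain additivity (`of_weight_mem_domainAddRel`): `(σ₁ ∪ σ₂) ∩ slab = (σ₁ ∩ slab) ∪ (σ₂ ∩ slab)`, the
  null overlap shrinks, the integrands still agree after multiplication by the common weight;
* integrand additivity (`of_weight_mem_integrandAddRel`): `s ^ m (f₁ + f₂) = s ^ m f₁ + s ^ m f₂`;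
* fibred changes of variables (`of_weight_mem_fibredChangeOfVariablesRel`): the substitution `Φ`
  preserves `z 0`, so it maps `σ ∩ slab` onto `σ' ∩ slab` and the weight `(Φ x 0) ^ m = (x 0) ^ m`
  factors through the Jacobian identity;
* fibred Newton–Leibniz moves (`of_weight_mem_newtonLeibnizRel`): the parameter is a base coordinate
  (`(Fin.init z) 0 = z 0`, `Fin.snoc_apply_zero`), so the weighted band is the band over the weighted
  base with the same bounds and the primitive `z ↦ (z 0) ^ m F z` (semialgebraic by closure of real
  semialgebraic functions under products, `IsSemialgebraicFunOn.mul_of_tarskiSeidenberg` with the proved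
  `tarski_seidenberg_real_holds`);

hence (`stub_weightMap_mem_fibredRelations`) the additive extension `FreeAbelianGroup.lift W` of ANY
map `W` on generators that kills dimension `0` and sends each family `[r]` to the class of some weighted
slab restriction of `r` maps `KZ.fibredRelations` into itself (`AddSubgroup.closure_le`, generatorwise, as
in `KZ.slabMap_mem_fibredRelations`). The companion `stub_exists_weightRestrict` constructs the weighted
slab restriction of a family: the domain `σ ∩ slab` is `ℚ`-semialgebraic, the integrand `(z 0) ^ m f` is
semialgebraic on it, and it is absolutely integrable because `|z 0| ^ m ≤ 1` on the slab
(`MeasureTheory.Integrable.bdd_mul`).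

Sources: M. Kontsevich, D. Zagier, *Periods* (2001), §1.2 (rules (1)–(3)); J. Bochnak, M. Coste,
M.-F. Roy, *Real Algebraic Geometry* (1998), Prop. 2.2.6. No new definitions; nothing here about slices,
constant terms or the specialisation map itself.
-/

noncomputable section

namespace Summit.KontsevichZagierPeriods.ValuedFieldSpecialisation

open MeasureTheory Set Filter MvPolynomial
open Literature.NumberTheory.Transcendental Literature.NumberTheory.Transcendental.KZ

variable {k m : ℕ}

/-- `FreeAbelianGroup.lift W` on the class `[r] = FreeAbelianGroup.of ⟨n, r⟩` of a representation is
`W ⟨n, r⟩` (`FreeAbelianGroup.lift_apply_of`). [folklore] -/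
theorem lift_of_eq (W : (Σ k, IntegralRep k) → FormalRep) {n : ℕ} (r : IntegralRep n) :
    FreeAbelianGroup.lift W (of r) = W ⟨n, r⟩ :=
  FreeAbelianGroup.lift_apply_of _ _

/-- **Polynomial weights are semialgebraic multipliers**: if `F` is a `ℚ`-semialgebraic function on
`s ⊆ ℝ^{n+1}` then so is `z ↦ (z 0) ^ m · F z` (the coordinate monomial is a polynomial function,
`isSemialgebraicFunOn_aeval`; products of real semialgebraic functions are semialgebraic,
`IsSemialgebraicFunOn.mul_of_tarskiSeidenberg` with `tarski_seidenberg_real_holds`).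
[Bochnak–Coste–Roy 1998, Prop. 2.2.6] [folklore] -/
theorem isSemialgebraicFunOn_pow_mul {n : ℕ} {s : Set (Fin (n + 1) → ℝ)} {F : (Fin (n + 1) → ℝ) → ℝ}
    (hF : IsSemialgebraicFunOn ℚ s F) :
    IsSemialgebraicFunOn ℚ s (fun z => z 0 ^ m * F z) := by
  have hs : Literature.ModelTheory.ExponentialFields.IsSemialgebraic ℚ s :=
    IsSemialgebraicFunOn.isSemialgebraic_holds hF
  have h1 : IsSemialgebraicFunOn ℚ s (fun z => z 0 ^ m) := by
    simpa using isSemialgebraicFunOn_aeval hs (X 0 ^ m : MvPolynomial (Fin (n + 1)) ℚ)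
  exact h1.mul_of_tarskiSeidenberg
    Literature.ModelTheory.ExponentialFields.tarski_seidenberg_real_holds hF

/-! ### The weighted slab restriction commutes with the four kinds of fibred generators -/

/-- **Weighted slab restriction of a domain-additivity instance** (dimension `≥ 1`) is a
domain-additivity instance: `(σ₁ ∪ σ₂) ∩ slab = (σ₁ ∩ slab) ∪ (σ₂ ∩ slab)`, the overlap is still null,
and the weighted integrands agree where the original ones do.
[Kontsevich–Zagier 2001, §1.2 rule (1)] [folklore] -/
theorem of_weight_mem_domainAddRel {r r₁ r₂ r' r₁' r₂' : IntegralRep (k + 1)} {a b : ℚ}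
    (hdom : r.domain = r₁.domain ∪ r₂.domain) (hnull : volume (r₁.domain ∩ r₂.domain) = 0)
    (h₁ : EqOn r.integrand r₁.integrand r₁.domain) (h₂ : EqOn r.integrand r₂.integrand r₂.domain)
    (hd : r'.domain = r.domain ∩ paramSlab k a b)
    (hi : r'.integrand = fun z => z 0 ^ m * r.integrand z)
    (hd₁ : r₁'.domain = r₁.domain ∩ paramSlab k a b)
    (hi₁ : r₁'.integrand = fun z => z 0 ^ m * r₁.integrand z)
    (hd₂ : r₂'.domain = r₂.domain ∩ paramSlab k a b)
    (hi₂ : r₂'.integrand = fun z => z 0 ^ m * r₂.integrand z) :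
    of r' - of r₁' - of r₂' ∈ domainAddRel := by
  refine ⟨k + 1, r', r₁', r₂', ?_, ?_, ?_, ?_, rfl⟩
  · rw [hd, hd₁, hd₂, hdom, union_inter_distrib_right]
  · rw [hd₁, hd₂]
    exact measure_mono_null (fun z hz => mem_inter hz.1.1 hz.2.1) hnull
  · intro z hz
    rw [hd₁] at hz
    simp only [hi, hi₁]
    rw [h₁ hz.1]
  · intro z hz
    rw [hd₂] at hz
    simp only [hi, hi₂]
    rw [h₂ hz.1]

/-- **Weighted slab restriction of an integrand-additivity instance** (dimension `≥ 1`) is an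
integrand-additivity instance: `s ^ m (f₁ + f₂) = s ^ m f₁ + s ^ m f₂` on the common cut domain.
[Kontsevich–Zagier 2001, §1.2 rule (1)] [folklore] -/
theorem of_weight_mem_integrandAddRel {r r₁ r₂ r' r₁' r₂' : IntegralRep (k + 1)} {a b : ℚ}
    (h₁ : r₁.domain = r.domain) (h₂ : r₂.domain = r.domain)
    (hadd : EqOn r.integrand (r₁.integrand + r₂.integrand) r.domain)
    (hd : r'.domain = r.domain ∩ paramSlab k a b)
    (hi : r'.integrand = fun z => z 0 ^ m * r.integrand z)
    (hd₁ : r₁'.domain = r₁.domain ∩ paramSlab k a b)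
    (hi₁ : r₁'.integrand = fun z => z 0 ^ m * r₁.integrand z)
    (hd₂ : r₂'.domain = r₂.domain ∩ paramSlab k a b)
    (hi₂ : r₂'.integrand = fun z => z 0 ^ m * r₂.integrand z) :
    of r' - of r₁' - of r₂' ∈ integrandAddRel := by
  refine ⟨k + 1, r', r₁', r₂', ?_, ?_, ?_, rfl⟩
  · rw [hd₁, hd, h₁]
  · rw [hd₂, hd, h₂]
  · intro z hz
    rw [hd] at hz
    simp only [hi, hi₁, hi₂, Pi.add_apply]
    rw [hadd hz.1, Pi.add_apply, mul_add]

/-- **Weighted slab restriction of a fibred change of variables is a fibred change of variables**: the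
substitution `Φ` preserves `z 0`, so it maps `σ ∩ slab` onto `σ' ∩ slab`, and the weight
`(Φ x 0) ^ m = (x 0) ^ m` passes through the Jacobian identity; all other clauses restrict.
[Kontsevich–Zagier 2001, §1.2 rule (2)] [folklore] -/
theorem of_weight_mem_fibredChangeOfVariablesRel {r r' ρ ρ' : IntegralRep (k + 1)} {a b : ℚ}
    {Φ : (Fin (k + 1) → ℝ) → (Fin (k + 1) → ℝ)}
    {Φ' : (Fin (k + 1) → ℝ) → (Fin (k + 1) → ℝ) →L[ℝ] (Fin (k + 1) → ℝ)}
    (hΦ : IsSemialgebraicMapOn ℚ r.domain Φ)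
    (hΦ' : ∀ x ∈ r.domain, HasFDerivWithinAt Φ (Φ' x) r.domain x) (hinj : InjOn Φ r.domain)
    (hdom : r'.domain = Φ '' r.domain)
    (hf : ∀ x ∈ r.domain, r.integrand x = r'.integrand (Φ x) * |(Φ' x).det|)
    (h0 : ∀ x ∈ r.domain, Φ x 0 = x 0)
    (hd : ρ.domain = r.domain ∩ paramSlab k a b)
    (hi : ρ.integrand = fun z => z 0 ^ m * r.integrand z)
    (hd' : ρ'.domain = r'.domain ∩ paramSlab k a b)
    (hi' : ρ'.integrand = fun z => z 0 ^ m * r'.integrand z) :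
    of ρ - of ρ' ∈ fibredChangeOfVariablesRel := by
  have hsub : ρ.domain ⊆ r.domain := hd ▸ inter_subset_left
  refine ⟨k, ρ, ρ', Φ, Φ', hΦ.mono hsub ρ.isSemialgebraic_domain,
    fun x hx => (hΦ' x (hsub hx)).mono hsub, hinj.mono hsub, ?_, ?_,
    fun x hx => h0 x (hsub hx), rfl⟩
  · rw [hd', hd]
    ext y
    simp only [mem_inter_iff, mem_image, mem_paramSlab]
    constructor
    · rintro ⟨hy, hya, hyb⟩
      rw [hdom] at hy
      obtain ⟨x, hx, rfl⟩ := hy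
      rw [h0 x hx] at hya hyb
      exact ⟨x, ⟨hx, hya, hyb⟩, rfl⟩
    · rintro ⟨x, ⟨hx, hxa, hxb⟩, rfl⟩
      rw [h0 x hx, hdom]
      exact ⟨mem_image_of_mem Φ hx, hxa, hxb⟩
  · intro x hx
    have hxr : x ∈ r.domain := hsub hx
    simp only [hi, hi']
    rw [h0 x hxr, hf x hxr, mul_assoc]

/-- **Weighted slab restriction of a Newton–Leibniz move over a base of dimension `≥ 1` is again such a
move**: the parameter `z 0` is a base coordinate (`(Fin.init z) 0 = z 0`, `(Fin.snoc x t) 0 = x 0`), so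
the weighted cut band is the band over the weighted cut base with the same bounds, the primitive being
`z ↦ (z 0) ^ m · F z` (constant weight along each fibre). [Kontsevich–Zagier 2001, §1.2 rule (3)]
[folklore] -/
theorem of_weight_mem_newtonLeibnizRel {r ρ : IntegralRep (k + 2)} {r' ρ' : IntegralRep (k + 1)}
    {a b : ℚ} {α β : (Fin (k + 1) → ℝ) → ℝ} {F : (Fin (k + 2) → ℝ) → ℝ}
    (hF : IsSemialgebraicFunOn ℚ r.domain F)
    (hα : IsSemialgebraicFunOn ℚ r'.domain α) (hβ : IsSemialgebraicFunOn ℚ r'.domain β)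
    (hle : ∀ x ∈ r'.domain, α x ≤ β x)
    (hband : r.domain = {z | (Fin.init z : Fin (k + 1) → ℝ) ∈ r'.domain ∧
      α (Fin.init z) ≤ z (Fin.last (k + 1)) ∧ z (Fin.last (k + 1)) ≤ β (Fin.init z)})
    (hcont : ∀ x ∈ r'.domain, ContinuousOn (fun t : ℝ => F (Fin.snoc x t)) (Icc (α x) (β x)))
    (hderiv : ∀ x ∈ r'.domain, ∀ t ∈ Ioo (α x) (β x),
      HasDerivAt (fun s : ℝ => F (Fin.snoc x s)) (r.integrand (Fin.snoc x t)) t)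
    (hr' : ∀ x ∈ r'.domain, r'.integrand x = F (Fin.snoc x (β x)) - F (Fin.snoc x (α x)))
    (hd : ρ.domain = r.domain ∩ paramSlab (k + 1) a b)
    (hi : ρ.integrand = fun z => z 0 ^ m * r.integrand z)
    (hd' : ρ'.domain = r'.domain ∩ paramSlab k a b)
    (hi' : ρ'.integrand = fun z => z 0 ^ m * r'.integrand z) :
    of ρ - of ρ' ∈ newtonLeibnizRel := by
  have hsub : ρ.domain ⊆ r.domain := hd ▸ inter_subset_left
  have hsub' : ρ'.domain ⊆ r'.domain := hd' ▸ inter_subset_left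
  refine ⟨k + 1, ρ, ρ', α, β, fun z => z 0 ^ m * F z,
    isSemialgebraicFunOn_pow_mul (hF.mono hsub ρ.isSemialgebraic_domain),
    hα.mono hsub' ρ'.isSemialgebraic_domain, hβ.mono hsub' ρ'.isSemialgebraic_domain,
    fun x hx => hle x (hsub' hx), ?_, ?_, ?_, ?_, rfl⟩
  · ext z
    simp only [hd, hd', hband, mem_inter_iff, mem_setOf_eq, mem_paramSlab]
    have h0 : Fin.init z 0 = z 0 := rfl
    rw [h0]
    tauto
  · intro x hx
    simp only [Fin.snoc_apply_zero]
    exact (hcont x (hsub' hx)).const_mul (x 0 ^ m)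
  · intro x hx t ht
    simp only [hi, Fin.snoc_apply_zero]
    exact (hderiv x (hsub' hx) t ht).const_mul (x 0 ^ m)
  · intro x hx
    simp only [hi', Fin.snoc_apply_zero]
    rw [hr' x (hsub' hx), mul_sub]

/-! ### The two stubs -/

/-- **Weighted slab restriction of a family exists** (stub `stub_exists_weightRestrict` of crux
`CTConstruction`, line `registered`): for every family `r : IntegralRep (k + 1)` and `m : ℕ` there is a
representation with domain `r.domain ∩ {0 < z 0 < 1}` and integrand `z ↦ (z 0) ^ m · r.integrand z` — the
cut domain is `ℚ`-semialgebraic (`KZ.isSemialgebraic_paramSlab`), the integrand is semialgebraic on it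
(`isSemialgebraicFunOn_pow_mul`) and absolutely integrable since `|z 0| ^ m ≤ 1` on the slab
(`MeasureTheory.Integrable.bdd_mul`). [Kontsevich–Zagier 2001, §1.1] [folklore] -/
theorem stub_exists_weightRestrict : ∀ (m k : ℕ) (r : Literature.NumberTheory.Transcendental.KZ.IntegralRep (k + 1)), ∃ r' : Literature.NumberTheory.Transcendental.KZ.IntegralRep (k + 1), r'.domain = r.domain ∩ Literature.NumberTheory.Transcendental.KZ.paramSlab k 0 1 ∧ r'.integrand = fun z => z 0 ^ m * r.integrand z := by
  intro m k r
  have hS : Literature.ModelTheory.ExponentialFields.IsSemialgebraic ℚ (r.domain ∩ paramSlab k 0 1) :=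
    r.isSemialgebraic_domain.inter (isSemialgebraic_paramSlab k 0 1)
  refine ⟨⟨r.domain ∩ paramSlab k 0 1, fun z => z 0 ^ m * r.integrand z, hS,
    isSemialgebraicFunOn_pow_mul (r.isSemialgebraicFunOn_integrand.mono inter_subset_left hS), ?_⟩,
    rfl, rfl⟩
  refine Integrable.bdd_mul (c := 1) (r.integrableOn.mono_set inter_subset_left)
    ((continuous_apply 0).pow m).aestronglyMeasurable ?_
  refine (ae_restrict_iff'
    (Literature.ModelTheory.ExponentialFields.IsSemialgebraic.measurableSet_holds hS)).mpr
    (Eventually.of_forall fun z hz => ?_)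
  simp only [mem_inter_iff, mem_paramSlab, Rat.cast_zero, Rat.cast_one] at hz
  rw [Real.norm_eq_abs, abs_pow]
  exact pow_le_one₀ (abs_nonneg _) (abs_le.mpr ⟨by linarith [hz.2.1], hz.2.2.le⟩)

/-- **Polynomial weights in the parameter preserve fibred relations** (stub
`stub_weightMap_mem_fibredRelations` of crux `CTConstruction`, line `registered`): let `W` be any map on
the generators of `KZ.FormalRep` sending every `0`-dimensional class to `0` and every family
`[r]`, `r : IntegralRep (k + 1)`, to the class `[r']` of SOME representation with
`r'.domain = r.domain ∩ {0 < z 0 < 1}` and `r'.integrand = (z 0) ^ m · r.integrand`; then the additive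
extension `FreeAbelianGroup.lift W` maps `KZ.fibredRelations` into `KZ.fibredRelations`. Proof:
`AddSubgroup.closure_le` on the comap, generatorwise (`of_weight_mem_domainAddRel`,
`of_weight_mem_integrandAddRel`, `of_weight_mem_fibredChangeOfVariablesRel`,
`of_weight_mem_newtonLeibnizRel`, the fibred Newton–Leibniz set unpacked by
`KZ.mem_fibredNewtonLeibnizRel_iff`); dimension-`0` additivity instances go to `0`.
[Kontsevich–Zagier 2001, §1.2 rules (1)–(3)] [folklore] -/
theorem stub_weightMap_mem_fibredRelations : ∀ (m : ℕ) (W : (Σ k, Literature.NumberTheory.Transcendental.KZ.IntegralRep k) → Literature.NumberTheory.Transcendental.KZ.FormalRep), (∀ r : Literature.NumberTheory.Transcendental.KZ.IntegralRep 0, W ⟨0, r⟩ = 0) → (∀ (k : ℕ) (r : Literature.NumberTheory.Transcendental.KZ.IntegralRep (k + 1)), ∃ r' : Literature.NumberTheory.Transcendental.KZ.IntegralRep (k + 1), W ⟨k + 1, r⟩ = Literature.NumberTheory.Transcendental.KZ.of r' ∧ r'.domain = r.domain ∩ Literature.NumberTheory.Transcendental.KZ.paramSlab k 0 1 ∧ r'.integrand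 = fun z => z 0 ^ m * r.integrand z) → ∀ c ∈ Literature.NumberTheory.Transcendental.KZ.fibredRelations, FreeAbelianGroup.lift W c ∈ Literature.NumberTheory.Transcendental.KZ.fibredRelations := by
  intro m W hW0 hfam c hc
  refine (AddSubgroup.closure_le (fibredRelations.comap (FreeAbelianGroup.lift W))).mpr ?_ hc
  rintro c (((hc | hc) | hc) | hc)
  · obtain ⟨k, r, r₁, r₂, hdom, hnull, h₁, h₂, rfl⟩ := hc
    rw [AddSubgroup.coe_comap, mem_preimage, map_sub, map_sub, lift_of_eq, lift_of_eq, lift_of_eq]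
    cases k with
    | zero =>
      rw [hW0, hW0, hW0, sub_zero, sub_zero]
      exact fibredRelations.zero_mem
    | succ k =>
      obtain ⟨r', hW, hd, hi⟩ := hfam k r
      obtain ⟨r₁', hW₁, hd₁, hi₁⟩ := hfam k r₁
      obtain ⟨r₂', hW₂, hd₂, hi₂⟩ := hfam k r₂
      rw [hW, hW₁, hW₂]
      exact mem_fibredRelations_of_mem_domainAddRel
        (of_weight_mem_domainAddRel hdom hnull h₁ h₂ hd hi hd₁ hi₁ hd₂ hi₂)
  · obtain ⟨k, r, r₁, r₂, h₁, h₂, hadd, rfl⟩ := hc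
    rw [AddSubgroup.coe_comap, mem_preimage, map_sub, map_sub, lift_of_eq, lift_of_eq, lift_of_eq]
    cases k with
    | zero =>
      rw [hW0, hW0, hW0, sub_zero, sub_zero]
      exact fibredRelations.zero_mem
    | succ k =>
      obtain ⟨r', hW, hd, hi⟩ := hfam k r
      obtain ⟨r₁', hW₁, hd₁, hi₁⟩ := hfam k r₁
      obtain ⟨r₂', hW₂, hd₂, hi₂⟩ := hfam k r₂
      rw [hW, hW₁, hW₂]
      exact mem_fibredRelations_of_mem_integrandAddRel
        (of_weight_mem_integrandAddRel h₁ h₂ hadd hd hi hd₁ hi₁ hd₂ hi₂)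
  · obtain ⟨k, r, r', Φ, Φ', hΦ, hΦ', hinj, hdom, hf, h0, rfl⟩ := hc
    rw [AddSubgroup.coe_comap, mem_preimage, map_sub, lift_of_eq, lift_of_eq]
    obtain ⟨ρ, hW, hd, hi⟩ := hfam k r
    obtain ⟨ρ', hW', hd', hi'⟩ := hfam k r'
    rw [hW, hW']
    exact mem_fibredRelations_of_mem_fibredChangeOfVariablesRel
      (of_weight_mem_fibredChangeOfVariablesRel hΦ hΦ' hinj hdom hf h0 hd hi hd' hi')
  · obtain ⟨k, r, r', α, β, F, hF, hα, hβ, hle, hband, hcont, hderiv, hr', rfl⟩ :=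
      mem_fibredNewtonLeibnizRel_iff.mp hc
    rw [AddSubgroup.coe_comap, mem_preimage, map_sub, lift_of_eq, lift_of_eq]
    obtain ⟨ρ, hW, hd, hi⟩ := hfam (k + 1) r
    obtain ⟨ρ', hW', hd', hi'⟩ := hfam k r'
    rw [hW, hW']
    exact mem_fibredRelations_of_mem_fibredNewtonLeibnizRel (of_sub_of_mem_fibredNewtonLeibnizRel
      (of_weight_mem_newtonLeibnizRel hF hα hβ hle hband hcont hderiv hr' hd hi hd' hi'))

end Summit.KontsevichZagierPeriods.ValuedFieldSpecialisation
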